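import Summits.SmoothPoincare4.SmoothPoincare4.Theses.ZeroSurgeryExotic
import Literature.Uncategorized.Crux
import Literature.Topology.FourManifolds.HomotopyBallSliceProofs
import Summits.SmoothPoincare4.SmoothPoincare4.Theorems.ZseSVanishesOnPairs.Negative.Position
import Summits.SmoothPoincare4.SmoothPoincare4.Theorems.ZeroSurgeryExoticAssembly2Record

/-!
# `ZseThesis` — negative knowledge I: a disproof of the crux is the kill switch, and SPC4 supplies it

Refuter support lemmas for crux `stmt-SmoothPoincare4-0364` (`ZeroSurgeryExotic.ZseThesis`, the route's target:
knots `K, K'` with a common `0`-surgery `Y`, `K` smoothly slice, `K'` not), from the standing disprover's work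
file `Summits/SmoothPoincare4/SmoothPoincare4/Cruxes/ZseThesis/Disproof.lean` §0–§1:

* `not_zseThesis_iff_assembly2` — `¬ ZseThesis` is literally the route's kill switch `Assembly2` (item 0367,
  "the `0`-surgery type determines smooth sliceness");
* `zseThesis_false_of_spc4` — `SmoothPoincare4` refutes the crux (Manolescu–Piccirillo Lemma 3.3, PROVED in the
  tree as `Literature.Uncategorized.isHomotopyBallSlice_of_zeroSurgeryPair`, then the contrapositive of the PROVED
  FGMW lemma, `isSmoothlySlice_of_isHomotopyBallSlice_of_spc4`): the crux is refutable only through a consequence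
  of the summit that is itself open in print;
* `zseThesis_false_of_not_zseHsliceNotSlice` — a disproof of the waypoint 0520 disproves the crux;
* `exotic_of_zseThesis` / `not_spc4_of_zseThesis` — a proof of the crux is a closed smooth `M ≃ₕ S⁴` with no
  diffeomorphism to `S⁴`: the crux is not junk-provable.
No definitions; no route item is concluded positively.
References: Manolescu–Piccirillo 2023, Lemma 3.3 and §1 p. 1 [ManolescuPiccirillo2023]; Freedman–Gompf–Morrison–Walker
2010, §1 [FreedmanGompfMorrisonWalker2010].

Repair 2026-08-17 (full-build breakage "42:52: Unknown identifier `Assembly2`"): the gate's items-cap autofix of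
2026-08-16T14:15:59Z dropped the route item `Assembly2` (stmt-SmoothPoincare4-0367) from `Theses/ZeroSurgeryExotic.lean`;
the constant is re-declared, under its original fully-qualified name and with its original definiens, in the
shared record module `Theorems/ZeroSurgeryExoticAssembly2Record.lean`, which this file now imports. Nothing else
changed (all statements and proofs byte-identical).
-/

noncomputable section

set_option linter.dupNamespace false

open scoped Manifold ContDiff
open ContinuousMap
open Literature.Topology.FourManifolds Literature.Uncategorized
open Summit.SmoothPoincare4.SmoothPoincare4.Theses.ZeroSurgeryExotic
open Summit.SmoothPoincare4.SmoothPoincare4.Theorems.ZseSVanishesOnPairs.Negative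

namespace Summit.SmoothPoincare4.SmoothPoincare4.Theorems.ZseThesis.Negative

/-- **`¬ ZseThesis` is the kill switch `Assembly2`** (item 0367), up to pushing the negation through the
quantifiers: DISPROVING the crux = PROVING "the `0`-surgery type of a knot determines its smooth sliceness".
[folklore] -/
theorem not_zseThesis_iff_assembly2 : ¬ ZseThesis ↔ Assembly2 := by
  constructor
  · intro h K K' Y _ _ h1 h2 h3
    by_contra h4
    exact h ⟨K, K', Y, _, _, h1, h2, h3, h4⟩
  · rintro h ⟨K, K', Y, _, _, h1, h2, h3, h4⟩
    exact h4 (h K K' Y h1 h2 h3)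

/-- Dually, the crux holds iff the kill switch fails. [folklore] -/
theorem zseThesis_iff_not_assembly2 : ZseThesis ↔ ¬ Assembly2 := by
  rw [← not_zseThesis_iff_assembly2, not_not]

/-- **`SmoothPoincare4` refutes the crux.** In any witness the partner `K'` is slice in a homotopy 4-ball
(Manolescu–Piccirillo Lemma 3.3 for `W = S⁴`, PROVED in the tree), hence smoothly slice under SPC4
(contrapositive of the FGMW lemma, PROVED via Palais' disc theorem) — contradicting the witness clause. So a
disproof of the crux needs an input of SPC4 strength: nothing strictly between `SmoothPoincare4` and `Assembly2`
is known. [cite: ManolescuPiccirillo2023, Lemma 3.3] -/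
theorem zseThesis_false_of_spc4 (hS : _root_.SmoothPoincare4) : ¬ ZseThesis := by
  rintro ⟨K, K', Y, _, _, h1, h2, h3, h4⟩
  exact h4 (isSmoothlySlice_of_isHomotopyBallSlice_of_spc4 hS (isHomotopyBallSlice_of_zeroSurgeryPair h1 h2 h3))

/-- **A disproof of the waypoint 0520 (`ZseHsliceNotSlice`: some knot is slice in a homotopy ball but not in
`B⁴`) disproves the crux**: every witness partner is such a knot. [cite: ManolescuPiccirillo2023, Lemma 3.3] -/
theorem zseThesis_false_of_not_zseHsliceNotSlice (h : ¬ ZseHsliceNotSlice) : ¬ ZseThesis := by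
  rintro ⟨K, K', Y, _, _, h1, h2, h3, h4⟩
  exact h ⟨K', isHomotopyBallSlice_of_zeroSurgeryPair h1 h2 h3, h4⟩

/-- **What a PROOF of the crux yields**: a closed smooth 4-manifold homotopy equivalent but not diffeomorphic to
`S⁴` (Manolescu–Piccirillo 3.3 + the FGMW lemma, both PROVED in the tree). So the crux is not junk-provable:
a Lean proof of it is a Lean disproof of the summit. [cite: FreedmanGompfMorrisonWalker2010, §1] -/
theorem exotic_of_zseThesis (h : ZseThesis) :
    ∃ (M : Type) (_ : TopologicalSpace M) (_ : T2Space M) (_ : SecondCountableTopology M)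
      (_ : ChartedSpace (EuclideanSpace ℝ (Fin 4)) M) (_ : IsManifold (𝓡 4) ∞ M) (_ : CompactSpace M),
      Nonempty (M ≃ₕ (Metric.sphere (0 : EuclideanSpace ℝ (Fin 5)) 1)) ∧
        IsEmpty (M ≃ₘ⟮𝓡 4, 𝓡 4⟯ (Metric.sphere (0 : EuclideanSpace ℝ (Fin 5)) 1)) := by
  obtain ⟨K, K', Y, _, _, h1, h2, h3, h4⟩ := h
  exact Knot.exists_exotic_of_isHomotopyBallSlice_not_isSmoothlySlice_holds
    ⟨K', isHomotopyBallSlice_of_zeroSurgeryPair h1 h2 h3, h4⟩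

/-- Hence the crux refutes the summit (contrapositive of `zseThesis_false_of_spc4`; the route's assembly in
one line, recorded here only as negative-side bookkeeping). [cite: ManolescuPiccirillo2023, §1 p. 1] -/
theorem not_spc4_of_zseThesis (h : ZseThesis) : ¬ _root_.SmoothPoincare4 :=
  fun hS ↦ zseThesis_false_of_spc4 hS h

end Summit.SmoothPoincare4.SmoothPoincare4.Theorems.ZseThesis.Negative

end
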